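import Summits.QuantumFields.YangMills.Theorems.UnitScaleTiltProp7FlatLocalMinimality
import Literature.MathematicalPhysics.QuantumFieldTheory.Balaban1983to89.T3PrintedRegularMinimiser
import HarnessLib

/-!
# Route `UnitScaleTilt`, crux K1 child «MinimiserStabilityRegPr» (stmt-QuantumFields-19200), registered stub `stub_prop7From14` (v4 828f5fb4a904d3be;
# V3 = `T3Thm1CarrierNative.Prop7From14At`) — sub-lemma V3-F♭ READ IN THE CARRIER's VOCABULARY: for a configuration of print's regular space (6)
# `𝔘_k(ε₀)` (`T3PrintedRegularMinimiser.RegPr F n K ε₀ U`) on the Landau ∕ `Q_{K−n}`-average-zero slice with bonds within `ε₂L^{−(K−n)}` of the identity,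
# `((2/17) − 96ε₀ − 7680ε₂²)·L^{−2(K−n)}·Σ_b‖U(b) − 1‖² ≤ A(U)` — the admissible `ε₀`, `ε₂` are ABSOLUTE numbers

Cell `ym3-torus` ∕ fleet seat `ym-ust-19200-p1` (HUMAN RULING D-0037, YM ladder rung R3).  A corollary of `UnitScaleTiltProp7FlatLocalMinimality`
(p459207, `Prop7FlatLocalMin.wilsonAction4_ge_quadratic_T3`) with the radii read off the route's carrier: the plaquette radius is print's (6)∕(2)
`|U(∂p) − 1| < ε₀L^{−2(K−n)}` (`RegPr`, plaquette clause = `PlaqSmall (regThreshold F n K ε₀)`), the bond radius is print's chart radius (19)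
`|ηA| < ε₂(L^jη)^{−1}η = ε₂L^{−k}` at the top scale.  Substituting `a = ε₀L^{−2(K−n)}`, `δ = ε₂L^{−(K−n)}` into the rate `(2/17)L^{−2(K−n)} − 96(a + 80δ²)`
gives `((2/17) − 96ε₀ − 7680ε₂²)·L^{−2(K−n)}`: POSITIVE as soon as, e.g., `ε₀ ≤ 1/1700` and `ε₂ ≤ 1/400` — thresholds depending on nothing (not on `L`,
the volume `m`, the height `n` or the run `K`), which is the sense of print's «absolute constants a₀, a′₁» (p. 299) in this flat-datum model.

WHAT IS PROVED (sorry-free, no definition): **`wilsonAction4_ge_of_regPr_T3`** (the displayed bound) and **`eq_one_of_regPr_of_wilsonAction4_eq_zero_T3`**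
(`ε₀ ≤ 1/1700`, `ε₂ ≤ 1/400`: a configuration of `𝔘_k(ε₀)` on the slice ∩ ball with `A(U) = 0` is `U ≡ 1`).  MODEL caveats as in the parent file (the
slice is the linear chart condition, not the family's (0.4)-fibre; nothing of Bałaban's is asserted).

References: T. Bałaban, CMP 102 (1985) 277–309 [Balaban1985Variational] ((2)/(6) p.278, (19) p.281, Prop. 7 and (141)–(143) p.299).
-/

noncomputable section

open scoped BigOperators Matrix.Norms.L2Operator

namespace Summit.QuantumFields.YangMills.Theorems.Prop7FlatLocalMin

open Literature.MathematicalPhysics.QuantumFieldTheory.Balaban1983to89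
open Finset LatticeFieldCalculus T3ContinuumYM3Torus T3RegularMinimiser T3PrintedRegularMinimiser

/-- **V3-F♭ ON PRINT's REGULAR SPACE (6) AT THE d = 3 CARRIER**: for an `SU(2)` configuration `U` of run `K` with `RegPr F n K ε₀ U` (`ε₀ ≥ 0`), in the
Landau gauge `∂^*(U − 1) = 0` with `Q_{K−n}(U − 1) = 0` and `‖U(b) − 1‖ ≤ ε₂L^{−(K−n)} ≤ 1` at every bond,
`((2/17) − 96ε₀ − 7680ε₂²)·L^{−2(K−n)}·Σ_b ‖U(b) − 1‖² ≤ A(U)`. [cite: Balaban1985Variational, (141)-(143) p.299] -/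
theorem wilsonAction4_ge_of_regPr_T3 (F : T3Family) (n K : ℕ) {ε₀ ε₂ : ℝ} (hε₀ : 0 ≤ ε₀)
    (U : GaugeField (F.P K) 0 (Matrix.specialUnitaryGroup (Fin 2) ℂ)) (hreg : RegPr F n K ε₀ U)
    (hδ : ∀ b : PBond (F.P K) 0, ‖(U b : Matrix (Fin 2) (Fin 2) ℂ) - 1‖ ≤ ε₂ * ((F.L : ℝ)⁻¹) ^ (K - n))
    (hδ1 : ε₂ * ((F.L : ℝ)⁻¹) ^ (K - n) ≤ 1)
    (hdiv : ∀ x : Site (F.P K) 0, diverg 1 (fun b : PBond (F.P K) 0 => (U b : Matrix (Fin 2) (Fin 2) ℂ) - 1) x = 0)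
    (havg : ∀ c : PBond (F.P K) (K - n), bondAvgIter (K - n) (fun b : PBond (F.P K) 0 => (U b : Matrix (Fin 2) (Fin 2) ℂ) - 1) c = 0) :
    ((2 / 17) - 96 * ε₀ - 7680 * ε₂ ^ 2) * (((F.L : ℝ) ^ (K - n)) ^ 2)⁻¹ * ∑ b : PBond (F.P K) 0, ‖(U b : Matrix (Fin 2) (Fin 2) ℂ) - 1‖ ^ 2
      ≤ wilsonAction4 U := by
  have hL : (0 : ℝ) < (F.L : ℝ) := by have := F.hL.2; exact_mod_cast (by omega : 0 < F.L)
  have hw : (0 : ℝ) < ((F.L : ℝ) ^ (K - n)) ^ 2 := by positivity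
  -- the plaquette radius `a = ε₀L^{-2(K-n)}` from `RegPr`
  have ha0 : 0 ≤ ε₀ * ((F.L : ℝ)⁻¹) ^ (2 * (K - n)) := by positivity
  have ha : ∀ p : Plaq (F.P K) 0, ‖((GaugeField.plaqHol U p : Matrix.specialUnitaryGroup (Fin 2) ℂ) : Matrix (Fin 2) (Fin 2) ℂ) - 1‖
      ≤ ε₀ * ((F.L : ℝ)⁻¹) ^ (2 * (K - n)) := by
    intro p
    have h := hreg.plaqSmall p
    exact h.le
  have h := wilsonAction4_ge_quadratic_T3 F n K U hδ hδ1 ha0 ha hdiv havg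
  -- the substitution `96(a + 80δ²) = (96ε₀ + 7680ε₂²)·L^{-2(K-n)}`
  have e1 : ((F.L : ℝ)⁻¹) ^ (2 * (K - n)) = (((F.L : ℝ) ^ (K - n)) ^ 2)⁻¹ := by
    rw [inv_pow, ← pow_mul, mul_comm]
  have e2 : (ε₂ * ((F.L : ℝ)⁻¹) ^ (K - n)) ^ 2 = ε₂ ^ 2 * (((F.L : ℝ) ^ (K - n)) ^ 2)⁻¹ := by
    rw [mul_pow, inv_pow, inv_pow]
  rw [e1, e2] at h
  have e3 : (2 / 17 * (((F.L : ℝ) ^ (K - n)) ^ 2)⁻¹ - 96 * (ε₀ * (((F.L : ℝ) ^ (K - n)) ^ 2)⁻¹ + 80 * (ε₂ ^ 2 * (((F.L : ℝ) ^ (K - n)) ^ 2)⁻¹)))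
      = ((2 / 17) - 96 * ε₀ - 7680 * ε₂ ^ 2) * (((F.L : ℝ) ^ (K - n)) ^ 2)⁻¹ := by ring
  rw [e3] at h
  exact h

/-- **ABSOLUTE THRESHOLDS**: with `ε₀ ≤ 1/1700` and `ε₂ ≤ 1/400` the rate is at least `(1/100)·L^{−2(K−n)}`, and a configuration of the regular space
(6) on the slice ∩ ball with vanishing Wilson action is `U ≡ 1`. [cite: Balaban1985Variational, Prop 7 p.299] -/
theorem eq_one_of_regPr_of_wilsonAction4_eq_zero_T3 (F : T3Family) (n K : ℕ) {ε₀ ε₂ : ℝ} (hε₀ : 0 ≤ ε₀) (hε₀' : ε₀ ≤ 1 / 1700)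
    (hε₂ : 0 ≤ ε₂) (hε₂' : ε₂ ≤ 1 / 400)
    (U : GaugeField (F.P K) 0 (Matrix.specialUnitaryGroup (Fin 2) ℂ)) (hreg : RegPr F n K ε₀ U)
    (hδ : ∀ b : PBond (F.P K) 0, ‖(U b : Matrix (Fin 2) (Fin 2) ℂ) - 1‖ ≤ ε₂ * ((F.L : ℝ)⁻¹) ^ (K - n))
    (hdiv : ∀ x : Site (F.P K) 0, diverg 1 (fun b : PBond (F.P K) 0 => (U b : Matrix (Fin 2) (Fin 2) ℂ) - 1) x = 0)
    (havg : ∀ c : PBond (F.P K) (K - n), bondAvgIter (K - n) (fun b : PBond (F.P K) 0 => (U b : Matrix (Fin 2) (Fin 2) ℂ) - 1) c = 0)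
    (hA : wilsonAction4 U = 0) : ∀ b : PBond (F.P K) 0, U b = 1 := by
  have hL1 : (1 : ℝ) ≤ (F.L : ℝ) := by have := F.hL.2; exact_mod_cast this.le
  have hLinv : ((F.L : ℝ)⁻¹) ^ (K - n) ≤ 1 := pow_le_one₀ (inv_nonneg.mpr (by linarith)) (inv_le_one_of_one_le₀ hL1)
  have hδ1 : ε₂ * ((F.L : ℝ)⁻¹) ^ (K - n) ≤ 1 := by
    have : ε₂ * ((F.L : ℝ)⁻¹) ^ (K - n) ≤ ε₂ * 1 := mul_le_mul_of_nonneg_left hLinv hε₂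
    linarith
  have h := wilsonAction4_ge_of_regPr_T3 F n K hε₀ U hreg hδ hδ1 hdiv havg
  rw [hA] at h
  have hw : (0 : ℝ) < (((F.L : ℝ) ^ (K - n)) ^ 2)⁻¹ := by
    have : (0 : ℝ) < (F.L : ℝ) := by linarith
    positivity
  have hrate : (1 / 100 : ℝ) ≤ (2 / 17) - 96 * ε₀ - 7680 * ε₂ ^ 2 := by nlinarith
  have hS0 : 0 ≤ ∑ b : PBond (F.P K) 0, ‖(U b : Matrix (Fin 2) (Fin 2) ℂ) - 1‖ ^ 2 := Finset.sum_nonneg fun _ _ => sq_nonneg _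
  have hS : ∑ b : PBond (F.P K) 0, ‖(U b : Matrix (Fin 2) (Fin 2) ℂ) - 1‖ ^ 2 = 0 := by
    by_contra hne
    have hpos : 0 < ∑ b : PBond (F.P K) 0, ‖(U b : Matrix (Fin 2) (Fin 2) ℂ) - 1‖ ^ 2 := lt_of_le_of_ne hS0 (Ne.symm hne)
    have : 0 < ((2 / 17) - 96 * ε₀ - 7680 * ε₂ ^ 2) * (((F.L : ℝ) ^ (K - n)) ^ 2)⁻¹
        * ∑ b : PBond (F.P K) 0, ‖(U b : Matrix (Fin 2) (Fin 2) ℂ) - 1‖ ^ 2 := by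
      have h1 : 0 < (2 / 17) - 96 * ε₀ - 7680 * ε₂ ^ 2 := by linarith
      positivity
    linarith
  intro b
  have hb := (Finset.sum_eq_zero_iff_of_nonneg fun b _ => sq_nonneg _).mp hS b (Finset.mem_univ b)
  have hb' : (U b : Matrix (Fin 2) (Fin 2) ℂ) = 1 := by
    have := pow_eq_zero_iff (n := 2) (by norm_num) |>.mp hb
    rwa [norm_eq_zero, sub_eq_zero] at this
  exact Subtype.ext hb'

end Summit.QuantumFields.YangMills.Theorems.Prop7FlatLocalMin

end
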